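import Summits.BirchSwinnertonDyer.BirchSwinnertonDyer.Theorems.ResidualThetaTransportAtTwoThetaLayerLambdaCongruenceAtTwoLayerAlgebra
import HarnessLib

/-!
# Crux `ThetaLayerLambdaCongruenceAtTwo` (stmt-BirchSwinnertonDyer-20688), line `birth`: ultrametric algebra of sums
# `∑ c_s Q^{e_s}` and the sup-norm ISOMETRY `(X+1)^s ↔ X^s`

Width seat bsd-wall-rtt-p3-w3 (`--supports stmt-BirchSwinnertonDyer-20688`; closes nothing). THEOREMS ONLY, route-independent
(no `Theses` import). Over an ultrametric normed field `K`:

* `supNorm_sum_C_mul_pow_le`: `‖∑_{i∈s} C(c_i)·Q^{e_i}‖_sup ≤ B` when `‖Q‖_sup ≤ 1` and all `‖c_i‖ ≤ B`;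
  `supNorm_comp_le`: `‖F∘Q‖_sup ≤ ‖F‖_sup` for `‖Q‖_sup ≤ 1`.
* THE ISOMETRY (`norm_le_supNorm_sum_C_mul_X_add_one_pow`, `supNorm_sum_C_mul_X_add_one_pow_le_iff`,
  `exists_supNorm_sum_C_mul_X_add_one_pow_eq`): `‖∑_{t mod m} c_t (X+1)^{t}‖_sup = max_t ‖c_t‖` — the base change between
  the group-ring basis `σ^t ↔ (X+1)^t` of `K[ℤ/m] ≅ K[X]/((X+1)^m − 1)` (degrees `< m`) and the monomial basis is
  unitriangular over `ℤ`. USE: the `μ`-invariant of a layer Mazur–Tate element `∑_a [a/pⁿ⁺ᵉ]⁺ σ_a` written in `T = γ − 1`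
  vanishes iff SOME plus symbol at that layer is a unit (companion file `…MuDictionary`).

References: [Washington1997] §7.1 (Gauss norm); [PollackWeston2011MT] §3.1 (layer invariants).
-/

noncomputable section

-- justification: the `Summit.BirchSwinnertonDyer.BirchSwinnertonDyer.…` path repeats a component (route-file convention)
set_option linter.dupNamespace false

open Polynomial

namespace Summit.BirchSwinnertonDyer.BirchSwinnertonDyer.Theorems.ThetaLayerLambdaCongruenceAtTwo

/-! ## Ultrametric algebra: sums `∑ c_s Q^{e_s}` and the isometry `(X+1)^s ↔ X^s` -/

section SupNorm

variable {K : Type*} [NormedField K] [IsUltrametricDist K]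

/-- `‖Q^e‖_sup ≤ 1` if `‖Q‖_sup ≤ 1` (Gauss's lemma). [folklore] -/
theorem supNorm_pow_le_one {Q : K[X]} (hQ : Q.supNorm ≤ 1) (e : ℕ) : (Q ^ e).supNorm ≤ 1 := by
  induction e with
  | zero => rw [pow_zero, ← C_1, supNorm_C, norm_one]
  | succ e ih =>
    rw [pow_succ, supNorm_mul']
    exact mul_le_one₀ ih (supNorm_nonneg _) hQ

omit [IsUltrametricDist K] in
/-- `‖X + 1‖_sup ≤ 1`. [folklore] -/
theorem supNorm_X_add_one_le : (X + 1 : K[X]).supNorm ≤ 1 := by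
  have h : (X + 1 : K[X]) = X + C 1 := by rw [C_1]
  rw [h]
  obtain ⟨i, hi⟩ := (X + C (1 : K)).exists_eq_supNorm
  rw [hi, coeff_add, coeff_X, coeff_C]
  by_cases h1 : i = 1
  · subst h1; simp
  · by_cases h0 : i = 0
    · subst h0; simp
    · rw [if_neg (Ne.symm h1), if_neg h0, add_zero, norm_zero]; exact zero_le_one

omit [IsUltrametricDist K] in
/-- `‖X − 1‖_sup ≤ 1`. [folklore] -/
theorem supNorm_X_sub_one_le : (X - 1 : K[X]).supNorm ≤ 1 := by
  have h : (X - 1 : K[X]) = X + C (-1) := by rw [C_neg, C_1, sub_eq_add_neg]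
  rw [h]
  obtain ⟨i, hi⟩ := (X + C (-1 : K)).exists_eq_supNorm
  rw [hi, coeff_add, coeff_X, coeff_C]
  by_cases h1 : i = 1
  · subst h1; simp
  · by_cases h0 : i = 0
    · subst h0; simp
    · rw [if_neg (Ne.symm h1), if_neg h0, add_zero, norm_zero]; exact zero_le_one

/-- **Sums of rescaled powers of an integral polynomial**: if `‖Q‖_sup ≤ 1` and `‖c_i‖ ≤ B` (`B ≥ 0`) for
`i ∈ s`, then `‖∑_{i∈s} C(c_i)·Q^{e_i}‖_sup ≤ B` (ultrametric inequality + Gauss's lemma). [folklore] -/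
theorem supNorm_sum_C_mul_pow_le {α : Type*} (s : Finset α) (c : α → K) (e : α → ℕ) {Q : K[X]}
    (hQ : Q.supNorm ≤ 1) {B : ℝ} (hB : 0 ≤ B) (hc : ∀ i ∈ s, ‖c i‖ ≤ B) :
    (∑ i ∈ s, C (c i) * Q ^ (e i)).supNorm ≤ B := by
  classical
  induction s using Finset.induction_on with
  | empty => rw [Finset.sum_empty, supNorm_zero]; exact hB
  | insert a s ha ih =>
    rw [Finset.sum_insert ha]
    refine (supNorm_add_le_max _ _).trans (max_le ?_ (ih fun i hi ↦ hc i (Finset.mem_insert_of_mem hi)))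
    rw [supNorm_C_mul]
    calc ‖c a‖ * (Q ^ e a).supNorm ≤ B * 1 :=
          mul_le_mul (hc a (Finset.mem_insert_self a s)) (supNorm_pow_le_one hQ _) (supNorm_nonneg _) hB
      _ = B := mul_one B

/-- `‖F.comp Q‖_sup ≤ ‖F‖_sup` when `‖Q‖_sup ≤ 1` (`F.comp Q = ∑_j F_j Q^j`). [folklore] -/
theorem supNorm_comp_le {Q : K[X]} (hQ : Q.supNorm ≤ 1) (F : K[X]) : (F.comp Q).supNorm ≤ F.supNorm := by
  rw [comp_eq_sum_left, Polynomial.sum_def]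
  exact supNorm_sum_C_mul_pow_le _ _ _ hQ (supNorm_nonneg F) fun j _ ↦ F.le_supNorm j

/-- **Lower bound of the isometry**: each coefficient `c_s` of `P = ∑_{t mod m} c_t (X+1)^{t}` has
`‖c_s‖ ≤ ‖P‖_sup`, because `P(X − 1) = ∑ c_t X^t` and `‖P(X−1)‖_sup ≤ ‖P‖_sup`. [folklore] -/
theorem norm_le_supNorm_sum_C_mul_X_add_one_pow {m : ℕ} [NeZero m] (c : ZMod m → K) (s : ZMod m) :
    ‖c s‖ ≤ (∑ t : ZMod m, C (c t) * (X + 1) ^ t.val).supNorm := by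
  set P : K[X] := ∑ t : ZMod m, C (c t) * (X + 1) ^ t.val with hP
  have hcomp : P.comp (X - 1) = ∑ t : ZMod m, C (c t) * X ^ t.val := by
    rw [hP, ← coe_compRingHom_apply, map_sum]
    refine Finset.sum_congr rfl fun t _ ↦ ?_
    rw [coe_compRingHom_apply, mul_comp, C_comp, pow_comp, add_comp, X_comp, one_comp, sub_add_cancel]
  have hcoeff : (P.comp (X - 1)).coeff s.val = c s := by
    rw [hcomp, finsetSum_coeff]
    simp only [coeff_C_mul_X_pow]
    have : ∀ t : ZMod m, (if s.val = t.val then c t else 0) = if s = t then c t else 0 := by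
      intro t
      by_cases h : s = t
      · subst h; simp
      · rw [if_neg h, if_neg (fun h' ↦ h ((ZMod.val_injective m) h'))]
    simp only [this, Finset.sum_ite_eq, Finset.mem_univ, if_true]
  calc ‖c s‖ = ‖(P.comp (X - 1)).coeff s.val‖ := by rw [hcoeff]
    _ ≤ (P.comp (X - 1)).supNorm := (P.comp (X - 1)).le_supNorm _
    _ ≤ P.supNorm := supNorm_comp_le supNorm_X_sub_one_le P

/-- **The isometry**: `‖∑_{t mod m} c_t (X+1)^{t}‖_sup ≤ B ↔ ∀ t, ‖c_t‖ ≤ B` (`B ≥ 0`). [folklore] -/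
theorem supNorm_sum_C_mul_X_add_one_pow_le_iff {m : ℕ} [NeZero m] (c : ZMod m → K) {B : ℝ} (hB : 0 ≤ B) :
    (∑ t : ZMod m, C (c t) * (X + 1) ^ t.val).supNorm ≤ B ↔ ∀ t, ‖c t‖ ≤ B :=
  ⟨fun h t ↦ (norm_le_supNorm_sum_C_mul_X_add_one_pow c t).trans h,
    fun h ↦ supNorm_sum_C_mul_pow_le _ _ _ supNorm_X_add_one_le hB fun t _ ↦ h t⟩

/-- **The isometry, attained form**: `‖∑_{t mod m} c_t (X+1)^{t}‖_sup = ‖c_s‖` for some `s` (the sup norm is the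
maximum of the `‖c_t‖`). [folklore] -/
theorem exists_supNorm_sum_C_mul_X_add_one_pow_eq {m : ℕ} [NeZero m] (c : ZMod m → K) :
    ∃ s : ZMod m, (∑ t : ZMod m, C (c t) * (X + 1) ^ t.val).supNorm = ‖c s‖ := by
  obtain ⟨s, -, hs⟩ := Finset.exists_max_image Finset.univ (fun t ↦ ‖c t‖) Finset.univ_nonempty
  exact ⟨s, le_antisymm (supNorm_sum_C_mul_pow_le _ _ _ supNorm_X_add_one_le (norm_nonneg _)
    fun t _ ↦ hs t (Finset.mem_univ t)) (norm_le_supNorm_sum_C_mul_X_add_one_pow c s)⟩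

end SupNorm

end Summit.BirchSwinnertonDyer.BirchSwinnertonDyer.Theorems.ThetaLayerLambdaCongruenceAtTwo

end
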